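import Summits.BirchSwinnertonDyer.BirchSwinnertonDyer.Theorems.CyclotomicUntwistDescendedFrobeniusOneModel
import Summits.BirchSwinnertonDyer.BirchSwinnertonDyer.Theorems.CyclotomicUntwistNineGaloisDescent
import Summits.BirchSwinnertonDyer.BirchSwinnertonDyer.Theorems.CyclotomicUntwistDescendedFrobeniusOfKatzThree
import HarnessLib

/-!
# The transport hypothesis `hT` of the Galois-descent file DISCHARGED: eigenvalue descent, no eigenvalue on the
# `ω`-line, independence of `([ω], φ[ω])`, `ℚ₃`-rationality of the `ω`-column — UNCONDITIONALLY — and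
# `isDescendedFrobeniusMatrix_exists` from the `η`-POSITION ON ONE GOOD MODEL (route `CyclotomicUntwist`)

Cell `pub/bsd-wall` (D-0145 line `route-BirchSwinnertonDyer-CyclotomicUntwist`), width seat `bsd-line-cycu-p4` (gen 8); the
1-screen glue between cycu-p1 g6's `CyclotomicUntwistNineGaloisDescent` (p635035), all of whose theorems take the binder
`hT : ∀ 𝓜₁ 𝓜₂ c d, HBD(φ[ω₂] − c[ω₂] − d[η₂]) → HBD(φ[ω₁] − c[ω₁] − d[η₁])` (transport of `ω`-column statements between good
models), and this seat's model-transport file `CyclotomicUntwistDescendedFrobeniusOneModel` (`hbd_omegaColumn_iff`), which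
PROVES `hT`. THEOREMS ONLY (no definition, no named fact, no `sorry`); helper `--supports` K1 = stmt-BirchSwinnertonDyer-21580
(serves K2 = 21581 and the print child C2 = 27549). BSD is not proved by this file and no crux / stub is.

* `omegaColumn_transport` — `hT` as a theorem (for every `W`);
* `eigenvalue_fixed'`, `not_hbd_expand_sub_C_mul_classOmega'`, `omegaPlane_independent'`, `omegaColumn_rational'` — the
  Galois-descent theorems WITHOUT the binder;
* **`isDescendedFrobeniusMatrix_exists_of_etaPosition_one`** — the Literature named fact
  `WeierstrassCurve.isDescendedFrobeniusMatrix_exists` FOLLOWS from the single statement «on a good model over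
  `𝓞_{ℚ₃(ζ₉)}` with supersingular special fibre, `[η] ≡ A[ω] + B·φ[ω]` modulo bounded denominators for some
  `A, B ∈ ℚ₃(ζ₉)`, `B ≠ 0`» (the `η`-position = Katz 1981 Thm 5.3.3, rank of `D(Ê/𝓞) ⊗ ℚ` = height = 2, read on the two
  Néron classes; `B ≠ 0` becomes automatic once `ClassesIndependent` is unconditional, cycu-p5's lane). Everything else in
  the definition of the descended Frobenius matrix — Frobenius relation, `det = 3`, `tr = a`, `M₁₀ ≠ 0`, descent to `ℚ₃`,
  all good models, independence — is kernel;
* **`isDescendedFrobeniusMatrix_exists_of_omegaColumnK_one`** — the SHARPEST form: the named fact follows from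
  «on one supersingular good model, `φ[ω] ≡ c[ω] + d[η]` for SOME `c, d ∈ ℚ₃(ζ₉)`» — no `d ≠ 0`, no independence, no
  rationality asked: `d ≠ 0` is forced (no eigenvalue on the `ω`-line), then `[η] = d⁻¹(φ[ω] − c[ω])` is an `η`-position;
* `isDescendedFrobeniusMatrix_exists_of_powerMapThree_one` — cycu-p3's KATZ3 interface (p634969) with its hypothesis on
  ONE model (`classesIndependent_iff`, `isPowerMapMatrix_iff`).

References: N. M. Katz, LNM 868 (1981) Thm 5.1.4, 5.3.3, 5.7.2 [Katz1981CrystallineDieudonne]; P. Berthelot, A. Ogus,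
Invent. Math. 72 (1983) (2.4), (3.14) [BerthelotOgus1983].
-/

set_option autoImplicit false
-- single-conjunct summit: `Summit.BirchSwinnertonDyer.BirchSwinnertonDyer.…` repeats the name by design
set_option linter.dupNamespace false

noncomputable section

open scoped Classical
open PowerSeries WeierstrassCurve Literature.NumberTheory.EllipticCurves.DescendedFrobenius
  Summit.BirchSwinnertonDyer.BirchSwinnertonDyer.Theorems
  Summit.BirchSwinnertonDyer.BirchSwinnertonDyer.Theorems.DescendedFrobeniusTransfer
  Summit.BirchSwinnertonDyer.BirchSwinnertonDyer.Theorems.DescendedFrobeniusOneModel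
  Summit.BirchSwinnertonDyer.BirchSwinnertonDyer.Theorems.NineGaloisDescent

namespace Summit.BirchSwinnertonDyer.BirchSwinnertonDyer.Theorems.NineNamedFactOfEtaPosition

/-- **The transport `hT` is a theorem**: an `ω`-column congruence `φ[ω] ≡ c[ω] + d[η]` (`φ = (z ↦ z³)^*`, `c, d ∈ ℚ₃(ζ₉)`)
moves between any two good models of `W` with the same coefficients (`DescendedFrobeniusOneModel.hbd_omegaColumn_iff`).
[cite: Katz1981CrystallineDieudonne, Thm. 5.1.4 and §5.1 (functoriality)] -/
theorem omegaColumn_transport (W : WeierstrassCurve ℚ) (𝓜₁ 𝓜₂ : W.NineGoodModel) (c d : KNine)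
    (h : HasBoundedDenominators (expand 3 (by norm_num) 𝓜₂.classOmega - PowerSeries.C c * 𝓜₂.classOmega -
      PowerSeries.C d * 𝓜₂.classEta)) :
    HasBoundedDenominators (expand 3 (by norm_num) 𝓜₁.classOmega - PowerSeries.C c * 𝓜₁.classOmega -
      PowerSeries.C d * 𝓜₁.classEta) := by
  simpa using (hbd_omegaColumn_iff 𝓜₁ 𝓜₂ 1 c d).mpr (by simpa using h)

variable {W : WeierstrassCurve ℚ}

/-- **Eigenvalues of `φ` on the `ω`-line are `Gal(ℚ₃(ζ₉)/ℚ₃)`-fixed** — cycu-p1's `eigenvalue_fixed`, unconditionally.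
[cite: BerthelotOgus1983, Prop. (3.14)] -/
theorem eigenvalue_fixed' (𝓜 : W.NineGoodModel) (ρ : ONine →+* ZMod 3) {lam : KNine}
    (h : HasBoundedDenominators (expand 3 (by norm_num) 𝓜.classOmega - PowerSeries.C lam * 𝓜.classOmega))
    (τ : KNine ≃ₐ[ℚ_[3]] KNine) : τ lam = lam :=
  eigenvalue_fixed 𝓜 ρ (omegaColumn_transport W) h τ

/-- **NO eigenvalue on the `ω`-line of a supersingular good model** (`φ[ω] ≢ λ[ω]` for every `λ ∈ ℚ₃(ζ₉)`) — cycu-p1's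
`not_hbd_expand_sub_C_mul_classOmega`, unconditionally. [cite: Katz1981CrystallineDieudonne, Thm. 5.3.3] -/
theorem not_hbd_expand_sub_C_mul_classOmega' (𝓜 : W.NineGoodModel) (ρ : ONine →+* ZMod 3)
    (hss : (3 : ℤ) ∣ 𝓜.specialFibreTrace ρ) (lam : KNine) :
    ¬ HasBoundedDenominators (expand 3 (by norm_num) 𝓜.classOmega - PowerSeries.C lam * 𝓜.classOmega) :=
  not_hbd_expand_sub_C_mul_classOmega 𝓜 ρ hss (omegaColumn_transport W) lam

/-- **`([ω], φ[ω])` is independent modulo bounded denominators on every supersingular good model** (rank of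
`D(Ê/𝓞) ⊗ ℚ` at least `2`, in kernel) — cycu-p1's `omegaPlane_independent`, unconditionally.
[cite: Katz1981CrystallineDieudonne, Thm. 5.3.3] -/
theorem omegaPlane_independent' (𝓜 : W.NineGoodModel) (ρ : ONine →+* ZMod 3)
    (hss : (3 : ℤ) ∣ 𝓜.specialFibreTrace ρ) (x y : KNine)
    (hxy : HasBoundedDenominators (PowerSeries.C x * 𝓜.classOmega +
      PowerSeries.C y * expand 3 (by norm_num) 𝓜.classOmega)) : x = 0 ∧ y = 0 :=
  omegaPlane_independent 𝓜 ρ hss (omegaColumn_transport W) x y hxy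

/-- **The `ω`-column is `ℚ₃`-RATIONAL**: if `φ[ω] ≡ c[ω] + d[η]` with `c, d ∈ ℚ₃(ζ₉)`, `d ≠ 0`, on a supersingular good model,
then `c, d ∈ ℚ₃` — cycu-p1's `omegaColumn_rational`, unconditionally. [cite: BerthelotOgus1983, Prop. (3.14)] -/
theorem omegaColumn_rational' (𝓜 : W.NineGoodModel) (ρ : ONine →+* ZMod 3) (hss : (3 : ℤ) ∣ 𝓜.specialFibreTrace ρ)
    {c d : KNine} (hd : d ≠ 0)
    (hω : HasBoundedDenominators (expand 3 (by norm_num) 𝓜.classOmega - PowerSeries.C c * 𝓜.classOmega -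
      PowerSeries.C d * 𝓜.classEta)) :
    ∃ c₀ d₀ : ℚ_[3], algebraMap ℚ_[3] KNine c₀ = c ∧ algebraMap ℚ_[3] KNine d₀ = d :=
  omegaColumn_rational 𝓜 ρ hss (omegaColumn_transport W) hd hω

/-- **THE NAMED FACT FROM THE `η`-POSITION ON ONE MODEL.** If for every `W/ℚ`, every good model `𝓜` over
`𝓞 = 𝓞_{ℚ₃(ζ₉)}` and every reduction map with supersingular special fibre (`3 ∣ a`) the second Néron class lies in the
`ω`-plane ON THAT MODEL — `[η] ≡ A[ω] + B·φ[ω]` modulo bounded denominators for some `A, B ∈ ℚ₃(ζ₉)` with `B ≠ 0`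
(Katz 1981 Thm 5.3.3: `D(Ê/𝓞) ⊗ ℚ` has rank `2`; with cycu-p1's independence of `([ω], φ[ω])` these two classes are a
basis) — then `WeierstrassCurve.isDescendedFrobeniusMatrix_exists` holds. (cycu-p1's
`isDescendedFrobeniusMatrix_exists_of_etaPosition` with its transport binder discharged by `omegaColumn_transport`.)
[cite: Katz1981CrystallineDieudonne, Thm. 5.3.3 and Thm. 5.7.2] [cite: BerthelotOgus1983, Thm. (2.4) and Prop. (3.14)] -/
theorem isDescendedFrobeniusMatrix_exists_of_etaPosition_one
    (hH : ∀ (W : WeierstrassCurve ℚ) (𝓜 : W.NineGoodModel) (ρ : ONine →+* ZMod 3),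
      (3 : ℤ) ∣ 𝓜.specialFibreTrace ρ →
        ∃ A B : KNine, B ≠ 0 ∧ HasBoundedDenominators (𝓜.classEta - PowerSeries.C A * 𝓜.classOmega -
          PowerSeries.C B * expand 3 (by norm_num) 𝓜.classOmega)) :
    WeierstrassCurve.isDescendedFrobeniusMatrix_exists :=
  isDescendedFrobeniusMatrix_exists_of_etaPosition omegaColumn_transport hH

/-- **THE NAMED FACT FROM THE `ω`-COLUMN WITH `ℚ₃(ζ₉)`-COEFFICIENTS ON ONE MODEL — no side condition.** If for every
`W/ℚ`, every good model `𝓜` over `𝓞` and every `ρ` with `3 ∣ a`, ON THAT MODEL `φ[ω] ≡ c[ω] + d[η]` modulo bounded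
denominators for SOME `c, d ∈ ℚ₃(ζ₉)` (`φ = (z ↦ z³)^*`; i.e. `φ[ω_W]` lies in the span of the two Néron classes in Katz's
`D(Ê/𝓞) ⊗ ℚ` — Katz 1981 Thm 5.3.3/5.7.2), then `WeierstrassCurve.isDescendedFrobeniusMatrix_exists`: `d ≠ 0` is forced by
`not_hbd_expand_sub_C_mul_classOmega'` (no eigenvalue on the `ω`-line of a supersingular model), and then
`[η] ≡ −(c/d)[ω] + d⁻¹φ[ω]` is an `η`-position with `d⁻¹ ≠ 0`. [cite: Katz1981CrystallineDieudonne, Thm. 5.3.3 and Thm. 5.7.2]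
[cite: BerthelotOgus1983, Thm. (2.4) and Prop. (3.14)] -/
theorem isDescendedFrobeniusMatrix_exists_of_omegaColumnK_one
    (hC : ∀ (W : WeierstrassCurve ℚ) (𝓜 : W.NineGoodModel) (ρ : ONine →+* ZMod 3),
      (3 : ℤ) ∣ 𝓜.specialFibreTrace ρ →
        ∃ c d : KNine, HasBoundedDenominators (expand 3 (by norm_num) 𝓜.classOmega -
          PowerSeries.C c * 𝓜.classOmega - PowerSeries.C d * 𝓜.classEta)) :
    WeierstrassCurve.isDescendedFrobeniusMatrix_exists := by
  refine isDescendedFrobeniusMatrix_exists_of_etaPosition_one fun W 𝓜 ρ hss => ?_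
  obtain ⟨c, d, h⟩ := hC W 𝓜 ρ hss
  have hd : d ≠ 0 := by
    rintro rfl
    rw [map_zero, zero_mul, sub_zero] at h
    exact not_hbd_expand_sub_C_mul_classOmega' 𝓜 ρ hss c h
  refine ⟨-(c * d⁻¹), d⁻¹, inv_ne_zero hd, ?_⟩
  have hk := hbd_C_mul (-d⁻¹) h
  have hdd : (PowerSeries.C d : KNine⟦X⟧) * PowerSeries.C d⁻¹ = 1 := by
    rw [← map_mul, mul_inv_cancel₀ hd, map_one]
  have e : PowerSeries.C (-d⁻¹) * (expand 3 (by norm_num) 𝓜.classOmega - PowerSeries.C c * 𝓜.classOmega -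
      PowerSeries.C d * 𝓜.classEta) =
      𝓜.classEta - PowerSeries.C (-(c * d⁻¹)) * 𝓜.classOmega - PowerSeries.C d⁻¹ * expand 3 (by norm_num) 𝓜.classOmega := by
    rw [map_neg, map_neg, map_mul]
    linear_combination 𝓜.classEta * hdd
  rwa [e] at hk

/-- **cycu-p3's KATZ3 interface on ONE model**: `isDescendedFrobeniusMatrix_exists` follows from «for every `W`, `𝓜`, `ρ` with
`3 ∣ a`: some `M ∈ M₂(ℚ₃)` with `ClassesIndependent 𝓜` and `IsPowerMapMatrix 𝓜 3 M` ON `𝓜`» (p634969 asked it for every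
good model of `W`; `classesIndependent_iff` / `isPowerMapMatrix_iff` supply the others).
[cite: Katz1981CrystallineDieudonne, Thm. 5.1.4 and Thm. 5.3.3] [cite: BerthelotOgus1983, Prop. (3.14)] -/
theorem isDescendedFrobeniusMatrix_exists_of_powerMapThree_one
    (hK : ∀ (W : WeierstrassCurve ℚ) (𝓜 : W.NineGoodModel) (ρ : ONine →+* ZMod 3),
      (3 : ℤ) ∣ 𝓜.specialFibreTrace ρ →
        ∃ M : Matrix (Fin 2) (Fin 2) ℚ_[3],
          𝓜.ClassesIndependent ∧ 𝓜.IsPowerMapMatrix 3 (by norm_num) (M.map (algebraMap ℚ_[3] KNine))) :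
    WeierstrassCurve.isDescendedFrobeniusMatrix_exists := by
  refine KatzFrobenius.isDescendedFrobeniusMatrix_exists_of_powerMapThree fun W 𝓜 ρ hss => ?_
  obtain ⟨M, hI, hP⟩ := hK W 𝓜 ρ hss
  exact ⟨M, fun 𝓜' => ⟨classesIndependent_of_classesIndependent 𝓜 𝓜' hI,
    (isPowerMapMatrix_iff_of_eq_pow 𝓜 𝓜' (k := 1) (by norm_num) (by norm_num) _).mp hP⟩⟩

end Summit.BirchSwinnertonDyer.BirchSwinnertonDyer.Theorems.NineNamedFactOfEtaPosition

end
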